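import Literature.Computability.MetaComplexity.EFPlainMFI
import Literature.Computability.MetaComplexity.EFModMulU
import HarnessLib

/-!
# Plain ripple-carry arithmetic: the shift-and-add integer multiplier

Layer P/3. The `L`-bit integer product `M(a, b) = Σ_t b_t · (a << t)` truncated to `L` bits
(no modular reduction), least significant multiplier bit first: `R_0 = 0`,
`R_{t+1} = R_t + mask(b_t, a << t)` with plain ripple-carry adders (carries above `L`
discarded). The template `Plain.Mul.mulPT L` (`2L + 1` inputs `a, b, zz`), its views (`ash`,
`msk`, `Rw`, `ADD`), and the availability of an occurrence.

## Sources

* H. Vollmer, *Introduction to Circuit Complexity* (Springer 1999), §1.2 (shift-and-add).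
* S. A. Cook, R. A. Reckhow, *The relative efficiency of propositional proof systems*,
  J. Symbolic Logic 44 (1979), §2.
-/

namespace Literature.Computability.MetaComplexity

open _root_.Computability Complexity Complexity.PropForm Netlist Cluster FregeSystem

namespace Plain

namespace Mul

variable (L : ℕ)

/-- Gates per stage: a mask row and an adder. [folklore] -/
def PS (L : ℕ) : ℕ := L + (2 * L + 1)

/-- Reference to bit `j` of `a << t` (zero fill). [folklore] -/
def ashRef (t j : ℕ) : ℕ ⊕ ℕ := if t ≤ j then Sum.inl (j - t) else Sum.inl (2 * L)
/-- Reference to bit `j` of `R_t` (`R_0 = 0`). [folklore] -/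
def RRef (t j : ℕ) : ℕ ⊕ ℕ := if t = 0 then Sum.inl (2 * L) else Sum.inr ((t - 1) * PS L + L + (2 * j + 1))

/-- The pieces: mask row `t` (piece `2t`), adder `t` (piece `2t + 1`). [cite: Vollmer1999, §1.2] -/
def pieces (L : ℕ) (k : ℕ) : Piece :=
  if k % 2 = 0 then ⟨ModMulU.maskRow L, L + 1, fun j => if j = 0 then Sum.inl (L + k / 2) else ashRef L (k / 2) (j - 1)⟩
  else ⟨Adder.addT false L, 2 * L, fun j => if j < L then RRef L (k / 2) j else Sum.inr (k / 2 * PS L + (j - L))⟩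

/-- Closed-form offsets. [folklore] -/
def offF (L : ℕ) (k : ℕ) : ℕ := k / 2 * PS L + (if k % 2 = 0 then 0 else L)

/-- **The integer multiplier.** [cite: Vollmer1999, §1.2] -/
def mulPT (L : ℕ) : Template := layout (pieces L) (2 * L)

/-- The closed form steps like the lengths. [folklore] -/
theorem offF_succ (k : ℕ) : offF L (k + 1) = offF L k + (pieces L k).T.length := by
  unfold offF pieces
  rcases Nat.mod_two_eq_zero_or_one k with h | h
  · have h1 : (k + 1) % 2 = 1 := by omega
    have h2 : (k + 1) / 2 = k / 2 := by omega
    simp [h, h1, h2]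
  · have h1 : (k + 1) % 2 = 0 := by omega
    have h2 : (k + 1) / 2 = k / 2 + 1 := by omega
    simp [h, h1, h2, PS]; ring

/-- **The offsets of the pieces are the closed forms.** [folklore] -/
theorem offset_pieces : ∀ k, offset (pieces L) k = offF L k := by
  intro k
  induction k with
  | zero => simp [offF]
  | succ k ih => rw [offset_succ, ih, offF_succ]

/-- Every piece is well formed and well wired (`2L + 1` inputs). [cite: Vollmer1999, Def. 1.6] -/
theorem piece_ok : ∀ k < 2 * L, Piece.OK (pieces L) (2 * L + 1) k := by
  intro k hk
  unfold Piece.OK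
  rw [offset_pieces]
  unfold pieces offF
  rcases Nat.mod_two_eq_zero_or_one k with h | h
  · simp only [h, if_true]
    refine ⟨ModMulU.wf_maskRow L, fun j hj => ?_⟩
    split_ifs with h0
    · exact ⟨fun a ha => (by cases ha; omega), fun g hg => by cases hg⟩
    · unfold ashRef; split_ifs <;> exact ⟨fun a ha => (by cases ha; omega), fun g hg => by cases hg⟩
  · simp only [h, show ¬(1 = 0) by omega, if_false]
    refine ⟨Adder.wf_addT false L, fun j hj => ?_⟩
    split_ifs with hjL
    · unfold RRef; split_ifs with h0
      · exact ⟨fun a ha => (by cases ha; omega), fun g hg => by cases hg⟩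
      · refine ⟨fun a ha => (by cases ha), fun g hg => ?_⟩
        cases hg
        have : (k / 2 - 1) * PS L + PS L = k / 2 * PS L := by rw [show k / 2 = k / 2 - 1 + 1 by omega, Nat.add_sub_cancel]; ring
        unfold PS at this ⊢; omega
    · exact ⟨fun a ha => (by cases ha), fun g hg => by cases hg; omega⟩

/-- **The multiplier is well formed** (`2L + 1` inputs). [cite: Vollmer1999, Def. 1.6] -/
theorem wf_mulPT : (mulPT L).WF (2 * L + 1) := wf_layout (pieces L) (piece_ok L)

/-- Length of the multiplier. [folklore] -/
theorem length_mulPT : (mulPT L).length = L * PS L := by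
  rw [mulPT, length_layout, offset_pieces]; unfold offF; simp

/-! ### Views -/

section Views

variable (o : Occ)

/-- `a`. [folklore] -/
def ain (i : ℕ) : ℕ := o.inp i
/-- The multiplier bits `b_t`. [folklore] -/
def bin (t : ℕ) : ℕ := o.inp (L + t)
/-- The zero gate. [folklore] -/
def zzv : ℕ := o.inp (2 * L)
/-- The word `a << t`. [folklore] -/
def ash (t j : ℕ) : ℕ := if t ≤ j then o.inp (j - t) else o.inp (2 * L)
/-- The masks `mask(b_t, a << t)`. [folklore] -/
def msk (t j : ℕ) : ℕ := o.base + (t * PS L + j)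
/-- The partial sums `R_t` (`R_0 = 0`). [folklore] -/
def Rw (t j : ℕ) : ℕ := if t = 0 then o.inp (2 * L) else o.base + ((t - 1) * PS L + L + (2 * j + 1))
/-- The adder of stage `t`: `R_{t+1} = R_t + mask_t`. [folklore] -/
def ADD (t : ℕ) : Adder.View := ⟨o.base + (t * PS L + L), Rw L o t, msk L o t⟩
/-- The definition line of a mask gate. [folklore] -/
def mDef (t j : ℕ) : PropForm ℕ := biimp (var (msk L o t j)) (conj (var (bin L o t)) (var (ash L o t j)))

/-- Availability of all stages. [folklore] -/
def PAvail (K : PropForm ℕ) (Γ : Set (PropForm ℕ)) : Prop :=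
  (∀ t < L, ∀ j < L, ctx K (mDef L o t j) ∈ Γ) ∧ ∀ t < L, (ADD L o t).Avail K Γ false L

end Views

variable {L} {o : Occ} {K : PropForm ℕ} {Γ : Set (PropForm ℕ)}

/-- The sum of stage `t` is `R_{t+1}`. [folklore] -/
theorem s_ADD (t j : ℕ) : (ADD L o t).s j = Rw L o (t + 1) j := by
  simp [ADD, Rw, Adder.View.s, Adder.View.wire, Nat.add_assoc]

/-- The references resolve. [folklore] -/
theorem ref_words {t j : ℕ} (hj : j < L) :
    (o.inst (2 * L + 1)).ref (ashRef L t j) = ash L o t j ∧ (o.inst (2 * L + 1)).ref (RRef L t j) = Rw L o t j := by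
  constructor
  · unfold ashRef ash; split_ifs <;> exact Occ.ref_inl o (by omega)
  · unfold RRef Rw; split_ifs
    · exact Occ.ref_inl o (by omega)
    · rw [Occ.ref_inr]; rfl

/-- The pieces by parity. [folklore] -/
theorem pieces_eq (t : ℕ) :
    pieces L (2 * t) = ⟨ModMulU.maskRow L, L + 1, fun j => if j = 0 then Sum.inl (L + t) else ashRef L t (j - 1)⟩ ∧
    pieces L (2 * t + 1) = ⟨Adder.addT false L, 2 * L, fun j => if j < L then RRef L t j else Sum.inr (t * PS L + (j - L))⟩ := by
  constructor
  · unfold pieces; rw [if_pos (by omega), show 2 * t / 2 = t by omega]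
  · unfold pieces; rw [if_neg (by omega), show (2 * t + 1) / 2 = t by omega]

/-- **All stages of an available occurrence are available.** [folklore] -/
theorem avail_ofOcc (ho : o.Avail (mulPT L) (2 * L + 1) K Γ) : PAvail L o K Γ := by
  constructor
  · intro t ht j hj
    obtain ⟨pm, -⟩ := pieces_eq (L := L) t
    have hq : (pieceOcc (o.inst (2 * L + 1)) (pieces L) (2 * t)).Avail (ModMulU.maskRow L) (L + 1) K Γ := by
      have := Inst.DefsAvail.piece ho (k := 2 * t) (by omega) (by rw [pm]; exact ModMulU.wf_maskRow L); rw [pm] at this; exact this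
    have := hq j (by rw [ModMulU.length_maskRow]; exact hj)
    rw [ModMulU.getElem_maskRow] at this
    have ew : ((pieceOcc (o.inst (2 * L + 1)) (pieces L) (2 * t)).inst (L + 1)).wire j = msk L o t j := by
      show o.base + offset (pieces L) (2 * t) + j = _
      rw [offset_pieces]; unfold offF msk; rw [if_pos (by omega), show 2 * t / 2 = t by omega]; simp [Nat.add_assoc]
    have e0 : ((pieceOcc (o.inst (2 * L + 1)) (pieces L) (2 * t)).inst (L + 1)).ref (Sum.inl 0) = bin L o t := by
      rw [Occ.ref_inl _ (by omega), inp_pieceOcc, pm]; dsimp only; rw [if_pos rfl]; exact Occ.ref_inl o (by omega)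
    have e1 : ((pieceOcc (o.inst (2 * L + 1)) (pieces L) (2 * t)).inst (L + 1)).ref (Sum.inl (1 + j)) = ash L o t j := by
      rw [Occ.ref_inl _ (by omega), inp_pieceOcc, pm]; dsimp only; rw [if_neg (by omega), show 1 + j - 1 = j by omega]; exact (ref_words hj).1
    simpa [Inst.body, Kind.body, Netlist.arg, ew, e0, e1, mDef] using this
  · intro t ht
    obtain ⟨-, pa⟩ := pieces_eq (L := L) t
    have hq : (pieceOcc (o.inst (2 * L + 1)) (pieces L) (2 * t + 1)).Avail (Adder.addT false L) (2 * L) K Γ := by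
      have := Inst.DefsAvail.piece ho (k := 2 * t + 1) (by omega) (by rw [pa]; exact Adder.wf_addT false L); rw [pa] at this; exact this
    refine Adder.View.Avail.congr (Adder.avail_viewOf hq) ?_ (fun i hi => ?_) (fun i hi => ?_)
    · show o.base + (t * PS L + L) = o.base + offset (pieces L) (2 * t + 1)
      rw [offset_pieces]; unfold offF; rw [if_neg (by omega), show (2 * t + 1) / 2 = t by omega]
    · show Rw L o t i = ((pieceOcc (o.inst (2 * L + 1)) (pieces L) (2 * t + 1)).inst (2 * L)).inputs.getD i 0
      rw [Occ.getD_inst _ (show i < 2 * L by omega)]; show _ = (pieceOcc _ _ (2 * t + 1)).inp i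
      rw [inp_pieceOcc, pa]; dsimp only; rw [if_pos hi]; exact ((ref_words hi).2).symm
    · show msk L o t i = ((pieceOcc (o.inst (2 * L + 1)) (pieces L) (2 * t + 1)).inst (2 * L)).inputs.getD (L + i) 0
      rw [Occ.getD_inst _ (show L + i < 2 * L by omega)]; show _ = (pieceOcc _ _ (2 * t + 1)).inp (L + i)
      rw [inp_pieceOcc, pa]; dsimp only; rw [if_neg (by omega), Nat.add_sub_cancel_left, Occ.ref_inr]; rfl

/-- Availability is monotone. [folklore] -/
theorem PAvail.mono {Γ' : Set (PropForm ℕ)} (h : PAvail L o K Γ) (hΓ : Γ ⊆ Γ') : PAvail L o K Γ' :=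
  ⟨fun t ht j hj => hΓ (h.1 t ht j hj), fun t ht => (h.2 t ht).mono hΓ⟩

end Mul

end Plain

end Literature.Computability.MetaComplexity
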